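import Literature.MathematicalPhysics.StatisticalMechanics.UNChiralCondensateLowerBound
import Literature.MathematicalPhysics.StatisticalMechanics.ComplexSpinFluctuationFiveSixCertificate
import HarnessLib

/-!
# Chiral symmetry breaking in the condensate form for the β = 0 U(N) model, every N, ν ≥ 4
# (Salmhofer–Seiler's Remark 4.10 (3), numerical hypothesis plugged in; conditional on the
# Hall–Puder–Sawin ∕ Amini zero-free fact)

A short file of the Salmhofer–Seiler series; theorems only (no definition, no named fact).
`UNChiralCondensateLowerBound` proves, for the `U(N)` model at `β = 0` and under the displayed
hypothesis `(h : HallPuderSawinAmini_uNZeroFree)` (`UNPartitionFunctionZeros`), the finite-volume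
form of (4.44): `⟨σ_0⟩_Λ(m) ≥ s₂(m) - ε` on all large even tori, and, when `2S(ν) < 1`, the
`m`-uniform bound `⟨σ_0⟩_Λ(m) ≥ (1 - 2S(ν))/(√(1 + 2νN(1 - 2S(ν))) + 1) - ε` for `0 < m ≤ 1`.
Here the numerical input is taken from the tree's kernel certificate `S(ν) < 0.35` for all `ν ≥ 4`
(`fluctS_lt_of_four_le`, Prop. 4.2 (4)), and the bounds are read in the thermodynamic limit:

* `uN_chiralSymmetryBreaking_condensate (h)` — `ν ≥ 4`, `N ≥ 1`, `0 < m ≤ 1`: on all large even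
  tori `⟨σ_0⟩_Λ(m) ≥ 3/(10(√(1 + 2νN) + 1)) - ε`, an explicit constant free of `m` and `Λ`;
* `uN_condensate_ge_of_tendsto (h)` — `ν ≥ 3`: every thermodynamic limit point `s` of `⟨σ_0⟩_Λ(m)`
  along even tori of diverging side satisfies `s ≥ s₂(m) = (√(m² + 2νN(1 - 2S(ν))) - m)/(2νN)`
  ((4.44) with `K(N) ↦ N`);
* `uN_condensate_limit_pos (h)` — `ν ≥ 4`: every such limit point at `0 < m ≤ 1` is
  `≥ 3/(10(√(1 + 2νN) + 1)) > 0`: the chiral order parameter `⟨ψ̄ψ⟩ = 2N⟨σ⟩` of the `β = 0` `U(N)`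
  lattice gauge theory stays bounded away from zero as `m → 0⁺`, for every `N` — Remark 4.10 (3)
  with its clustering hypothesis discharged by `h` (limit points exist along subsequences by
  `uN_exists_subseq_tendsto_expect_allN`, Thm. 3.18 (2)).

Honest framing: `β = 0`, gauge group `U(N)`, one staggered flavour, even tori, real mass;
CONDITIONAL on the vendored fact `h` (Q1 vend #1 of the cell pub-ymgap); `ν = 3` is not covered
(`2S(3) > 1` for the sharp constant); nothing about `SU(N)`, `β > 0`, the continuum, a mass gap or
the summit's `QCD` conjunct.

## References

* M. Salmhofer, E. Seiler, *Proof of chiral symmetry breaking in strongly coupled lattice gauge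
  theory*, Commun. Math. Phys. 139 (1991) 395–432: Remark 4.10 (3) (4.44), Cor. 4.4 (1),
  Prop. 4.2 (4), Thm. 3.18 (2). [SalmhoferSeiler1991]
* N. Amini, arXiv:1905.02264, Thm. 3.7. [Amini2019]
* C. Hall, D. Puder, W. F. Sawin, Adv. Math. 323 (2018) 367–410, §2.2, §5.2. [HallPuderSawin2018]
-/

noncomputable section

open MvPolynomial Finset Filter Topology
open Literature.Probability.LatticeModels (TorusSite Site)
open Literature.Probability.LatticeModels

namespace Literature.MathematicalPhysics.StatisticalMechanics

namespace ComplexSpin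

variable {ν N : ℕ}

/-- From "`≥ c - ε` on all large even tori, every `ε`" to "`≥ c`" for thermodynamic limit points.
[folklore] -/
private theorem le_of_tendsto_of_forall_eps {c : ℝ} {m : ℝ} {a : ℕ → ℝ}
    (hb : ∀ ε : ℝ, 0 < ε → ∃ L₀ : ℕ, ∀ (L : ℕ) [NeZero L], Even L → L₀ ≤ L →
      c - ε ≤ expect N m a (X (0 : TorusSite ν L)))
    (Ls : ℕ → ℕ) [∀ j, NeZero (Ls j)] (heven : ∀ j, Even (Ls j)) (hLs : Tendsto Ls atTop atTop)
    {s : ℝ} (hs : Tendsto (fun j => expect (ν := ν) (L := Ls j) N m a (X 0)) atTop (𝓝 s)) :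
    c ≤ s := by
  refine le_of_forall_pos_le_add fun ε hε => ?_
  obtain ⟨L₀, hL₀⟩ := hb ε hε
  have hev : ∀ᶠ j in atTop, c - ε ≤ expect (ν := ν) (L := Ls j) N m a (X 0) := by
    filter_upwards [tendsto_atTop.1 hLs L₀] with j hj
    exact hL₀ (Ls j) (heven j) hj
  have := ge_of_tendsto hs hev
  linarith

/-- **(4.44) for thermodynamic limit points, `U(N)`, every `N ≥ 1`** (given the vendored fact): for
`ν ≥ 3`, `m > 0`, every limit `s` of `⟨σ_0⟩_Λ(m)` along a sequence of even tori of diverging side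
satisfies `s ≥ s₂(m) = (√(m² + 2νN(1 - 2S(ν))) - m)/(2νN)`. [cite: SalmhoferSeiler1991, Remark 4.10 (3) (4.44) and Thm. 4.3 (4.8)][cite: Amini2019, Thm. 3.7][cite: HallPuderSawin2018, §2.2 and §5.2] -/
theorem uN_condensate_ge_of_tendsto (h : HallPuderSawinAmini_uNZeroFree) (hν : 3 ≤ ν) (hN : 1 ≤ N)
    {m : ℝ} (hm : 0 < m) (Ls : ℕ → ℕ) [∀ j, NeZero (Ls j)] (heven : ∀ j, Even (Ls j))
    (hLs : Tendsto Ls atTop atTop) {s : ℝ}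
    (hs : Tendsto (fun j => expect (ν := ν) (L := Ls j) N m (uNBondCoeff N) (X 0)) atTop (𝓝 s)) :
    (Real.sqrt (m ^ 2 + 2 * ν * N * (1 - 2 * fluctS ν)) - m) / (2 * ν * N) ≤ s :=
  le_of_tendsto_of_forall_eps (fun _ hε => uN_condensate_lower_bound h hν hN hm hε) Ls heven hLs hs

/-- `2S(ν) < 1` for `ν ≥ 4` (indeed `S(ν) < 0.35`, Prop. 4.2 (4), certified in the tree).
[cite: SalmhoferSeiler1991, Prop. 4.2 (4) and Cor. 4.4 (1)] -/
theorem two_mul_fluctS_lt_one (hν : 4 ≤ ν) : 2 * fluctS ν < 1 := by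
  linarith [fluctS_lt_of_four_le hν]

/-- The `m`-uniform constant of `uN_chiralCondensate_pos` is at least `3/(10(√(1 + 2νN) + 1))` when
`ν ≥ 4`. [cite: SalmhoferSeiler1991, Prop. 4.2 (4) and Remark 4.10 (3)] -/
theorem uN_chiralCondensate_const_ge (hν : 4 ≤ ν) (N : ℕ) :
    3 / (10 * (Real.sqrt (1 + 2 * ν * N) + 1)) ≤
      (1 - 2 * fluctS ν) / (Real.sqrt (1 + 2 * ν * N * (1 - 2 * fluctS ν)) + 1) := by
  have hS := fluctS_lt_of_four_le hν
  have hS0 : 0 ≤ fluctS ν := fluctS_nonneg ν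
  set κ : ℝ := 1 - 2 * fluctS ν with hκ
  have hκ3 : 3 / 10 ≤ κ := by rw [hκ]; linarith
  have hκ1 : κ ≤ 1 := by rw [hκ]; linarith
  have hA : (0 : ℝ) ≤ 2 * ν * N := by positivity
  have hsqrt : Real.sqrt (1 + 2 * ν * N * κ) ≤ Real.sqrt (1 + 2 * ν * N) :=
    Real.sqrt_le_sqrt (by nlinarith)
  have hden : 0 < Real.sqrt (1 + 2 * ν * N * κ) + 1 := by positivity
  have hden' : 0 < Real.sqrt (1 + 2 * (ν : ℝ) * N) + 1 := by positivity
  calc 3 / (10 * (Real.sqrt (1 + 2 * ν * N) + 1)) = (3 / 10) / (Real.sqrt (1 + 2 * ν * N) + 1) := by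
        rw [div_div]
    _ ≤ κ / (Real.sqrt (1 + 2 * ν * N) + 1) := div_le_div_of_nonneg_right hκ3 hden'.le
    _ ≤ κ / (Real.sqrt (1 + 2 * ν * N * κ) + 1) :=
        div_le_div_of_nonneg_left (by linarith) hden (by linarith)

/-- **Chiral symmetry breaking in the condensate form for the `β = 0` `U(N)` lattice gauge theory,
every `N ≥ 1`, `ν ≥ 4`** (Remark 4.10 (3) with the numerical input of Prop. 4.2 (4), conditional on
the vendored zero-free fact): for every mass `0 < m ≤ 1` and every `ε > 0`, on all large even tori
`⟨σ_0⟩_Λ(m) ≥ 3/(10(√(1 + 2νN) + 1)) - ε` — a positive constant independent of `m` and `Λ`.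
[cite: SalmhoferSeiler1991, Remark 4.10 (3) (4.44), Cor. 4.4 (1) and Prop. 4.2 (4)][cite: Amini2019, Thm. 3.7][cite: HallPuderSawin2018, §2.2 and §5.2] -/
theorem uN_chiralSymmetryBreaking_condensate (h : HallPuderSawinAmini_uNZeroFree) (hν : 4 ≤ ν)
    (hN : 1 ≤ N) {m : ℝ} (hm : 0 < m) (hm1 : m ≤ 1) {ε : ℝ} (hε : 0 < ε) :
    ∃ L₀ : ℕ, ∀ (L : ℕ) [NeZero L], Even L → L₀ ≤ L →
      3 / (10 * (Real.sqrt (1 + 2 * ν * N) + 1)) - ε ≤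
        expect N m (uNBondCoeff N) (X (0 : TorusSite ν L)) := by
  obtain ⟨L₀, hL₀⟩ := uN_chiralCondensate_pos (ν := ν) h (by omega) hN (two_mul_fluctS_lt_one hν)
    hm hm1 hε
  refine ⟨L₀, fun L _ hL hLe => le_trans ?_ (hL₀ L hL hLe)⟩
  linarith [uN_chiralCondensate_const_ge hν N]

/-- **The chiral order parameter of the `β = 0` `U(N)` model is bounded away from zero as
`m → 0⁺`, every `N ≥ 1`, `ν ≥ 4`** (given the vendored fact): every thermodynamic limit point `s`
of `⟨σ_0⟩_Λ(m)` along even tori of diverging side, at any mass `0 < m ≤ 1`, satisfies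
`s ≥ 3/(10(√(1 + 2νN) + 1)) > 0` (so `liminf_{m→0⁺} ⟨ψ̄ψ⟩ ≥ 2N · 3/(10(√(1 + 2νN) + 1)) > 0`).
[cite: SalmhoferSeiler1991, Remark 4.10 (3) (4.44) and Cor. 4.4 (1)][cite: Amini2019, Thm. 3.7][cite: HallPuderSawin2018, §2.2 and §5.2] -/
theorem uN_condensate_limit_pos (h : HallPuderSawinAmini_uNZeroFree) (hν : 4 ≤ ν) (hN : 1 ≤ N)
    {m : ℝ} (hm : 0 < m) (hm1 : m ≤ 1) (Ls : ℕ → ℕ) [∀ j, NeZero (Ls j)]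
    (heven : ∀ j, Even (Ls j)) (hLs : Tendsto Ls atTop atTop) {s : ℝ}
    (hs : Tendsto (fun j => expect (ν := ν) (L := Ls j) N m (uNBondCoeff N) (X 0)) atTop (𝓝 s)) :
    3 / (10 * (Real.sqrt (1 + 2 * ν * N) + 1)) ≤ s ∧ 0 < s := by
  have h1 : 3 / (10 * (Real.sqrt (1 + 2 * ν * N) + 1)) ≤ s :=
    le_of_tendsto_of_forall_eps
      (fun _ hε => uN_chiralSymmetryBreaking_condensate h hν hN hm hm1 hε) Ls heven hLs hs
  have h0 : 0 < 3 / (10 * (Real.sqrt (1 + 2 * (ν : ℝ) * N) + 1)) := by positivity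
  exact ⟨h1, lt_of_lt_of_le h0 h1⟩

end ComplexSpin

end Literature.MathematicalPhysics.StatisticalMechanics

end
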